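import Summits.PneNP.PneNP.Theorems.ChebyshevTracialDesignSmallBlockClassWeights
import Summits.PneNP.PneNP.Theorems.ChebyshevTracialDesignVirtualPositivityCriterion
import Summits.PneNP.PneNP.Theorems.ChebyshevTracialDesignShellOperatorForm
import Literature.Combinatorics.Optimization.ShellLawSmallBlockSmoothness
import Literature.Combinatorics.Optimization.ExactDesignWeightedRemainder
import HarnessLib

/-!
# Cell pnp-psdrank, route `ChebyshevTracialDesign`: SMALL BLOCKS WITH INTERNAL MATCHING EDGES — THE UNTILTED MASK
# PRICED PER MATCHING (brick T-K3; crux `TracialDecayExp20`, stmt-PneNP-19878)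

Brick (T-K3) (engine seat g24; eng MEMO-23 §2). A block `H` of `H`-type `(a,b,d)` — `a` matching edges inside, `b`
crossing — is priced through the `HH`-CLASS REDUCTION (K0): conditioning on the states of the `a` internal edges
(`f` full, `g` half, `e = a−f−g` empty) writes the shell profile of a mask `ψ(|U∩H|)` as
`φ_M(c) = Σ_{f,g} p_{fg}(c)·Φ_{fg}(c)` with the CLASS WEIGHTS `p_{fg}` — polynomials of degree `a` in the level
(`ChebyshevTracialDesignSmallBlockClassWeights`) that VANISH at the virtual level `c = 0` on every class with a half
internal edge — and the CLASS PROFILES `Φ_{fg}(c) = Σ_x ψ(x)·law_{S∖AA}(t−2f−g, c−g; x−2f−g)`, shifted mixtures of the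
shell laws of the `a = 0` block `H` inside the ground set `S∖AA` (the `HH` class removed), which are `q`-smooth at every
level index and of either parity (`ShellLawSmallBlockSmoothness` §4). The exact-design remainder for polynomially
weighted profiles (`ExactDesignWeightedRemainder`, base-shifted form for the half-edge classes) then prices each class:
the `g ≥ 1` classes are PURE REMAINDER, the `g = 0` classes have main term `−p_{f0}(0)·N^{odd}_{D−a}Φ_{f0}(0) ≤ 0`
by the virtual positivity of the inner `a = 0` block (brick 121's criterion fed by `ShellLawSmallBlockSmoothness`).

* §1 `sdiff_vAA_facts` (the reduced ground set `univ ∖ AA`: stable, `2(N−a)` vertices, no internal edge, the same `b`).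
* §2 **`classProfile_virtual_nonneg`** — `N^{odd}_{D'}[Φ_{f0}](0) ≥ 0` for the full/empty classes.
* §3 **`smallBlockHH_designValue_le_of_split`** (THE PRICING modulo the (K0) law identity as an explicit hypothesis
  `hK0`) and **`smallBlockHH_designValue_le`** (unconditional: `hK0` is lit g37's `ShellLawPopulationMixture` §9
  `shellLaw_eq_sum_split_hh_descFactorial`): for an exact design `(n,t,T,D,B_v,C,w)`, a matching
  `M`, a block `H` with `a` internal and `b` crossing edges, `t = 2s₀+1`, `a + D' = D`, `R ≥ 1` with
  `R + 3(D'+1) + b + a + (T−1)/2 ≤ s₀ + 1`, `R + 3(D'+1) + b + a + s₀ + (T−1)/2 + 1 ≤ N`, `(b/R)²e^{3b/R} ≤ 2`, and every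
  `0 ≤ ψ ≤ G`: `|PM|·Σ_U W(U,M)·ψ(|U∩H|) ≤ B_v·C((T−1)/2, D'+1)·3^a·G·q^{D'+1}`, `q = ¼(b/R)²e^{3b/R}`.
READING (eng MEMO-23 §2): per matching, EVERY small block is priced at `3^a·q^{D−a+1}` — the obstruction of eng
MEMO-22 §10c (the half-`HH` weights `(2j+1)_g` are not slowly varying) never arises, because those weights are
polynomial in the level and vanish at the virtual level: nothing is differenced relative to them. With the `a`-tail of
the matching measure (`P_M(a(M,H) ≥ a₀) ≤ (h²/n)^{a₀}/a₀!`) this is the input of the M-average for `|H| ≤ n^{1/2−ε}`.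
WHAT THIS FILE DOES NOT DO: the M-average, tilted masks; anything on `TracialDecayExp20` itself, psd rank of
P_PM(K_n), or P vs NP. [cite: Rothvoss2017, §2 (PDF p. 6)] [cite: Agarwal2000DifferenceEquations, Remark 1.8.1 (1.8.8)]
[cite: ChattamvelliShanmugam2020, §7.4]
Stature: support/instrument (kernel lane, no defs, axioms standard). Supports stmt-PneNP-19878.
-/

set_option linter.dupNamespace false -- `Summit.PneNP.PneNP.…`: summit = sub-problem (D-0017)

noncomputable section

namespace Summit.PneNP.PneNP.Theorems.ChebyshevTracialDesignSmallBlockMaskPricingHH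

open Finset Polynomial Literature.Barriers.PneNP Literature.Combinatorics.Optimization
open Literature.Combinatorics.Optimization.ShellStep
open Summit.PneNP.PneNP.Theorems.ChebyshevTracialDesignVirtualPositivityCriterion (newtonPolyOdd_eval_zero_mixture_ge)
open Summit.PneNP.PneNP.Theorems.ChebyshevTracialDesignShellOperatorForm (designValue_eq_shellAvg)
open Summit.PneNP.PneNP.Theorems.ChebyshevTracialDesignSmallBlockClassWeights

variable {n : ℕ}

/-! ### §1 The reduced ground set -/

section Reduced

variable {π : Fin n → Fin n} (hπ : ∀ v, π (π v) = v) (hπ' : ∀ v, π v ≠ v)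
include hπ hπ'

/-- **The ground set with the `HH` class removed.** For a perfect matching `π` of the `2N` vertices and a block `H` with
`a` internal edges: `S′ = univ ∖ AA` is `π`-stable, has `2(N−a)` vertices, contains no edge inside `H`, and its classes of
edges meeting `H` are those of the full ground set. [cite: Rothvoss2017, §2 (PDF p. 5)] -/
theorem sdiff_vAA_facts {N : ℕ} (hn : (univ : Finset (Fin n)).card = 2 * N) (H : Finset (Fin n)) {a : ℕ}
    (ha : (reps π (vAA π univ H)).card = a) :
    (∀ v ∈ univ \ vAA π univ H, π v ∈ univ \ vAA π univ H) ∧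
      (univ \ vAA π univ H).card = 2 * (N - a) ∧
      (reps π (vAA π (univ \ vAA π univ H) H)).card = 0 ∧
      vBH π (univ \ vAA π univ H) H ∪ vBN π (univ \ vAA π univ H) H = vBH π univ H ∪ vBN π univ H := by
  have hS : ∀ v ∈ (univ : Finset (Fin n)), π v ∈ univ := fun v _ => mem_univ _
  have hst := (sdiff_vAA_noHH hπ hS H).1
  have hA := vAA_stable hπ univ H hS
  have h2a := two_mul_card_reps hπ hπ' hA
  rw [ha] at h2a
  refine ⟨hst, ?_, ?_, ?_⟩
  · rw [card_sdiff_of_subset (subset_univ _), hn, ← h2a]; omega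
  · have h0 : vAA π (univ \ vAA π univ H) H = ∅ := by
      refine filter_eq_empty_iff.2 fun v hv h => ?_
      exact (mem_sdiff.1 hv).2 (mem_vAA.2 ⟨mem_univ _, h.1, h.2⟩)
    rw [h0]; simp [reps]
  · ext v
    simp only [mem_union, mem_vBH, mem_vBN, mem_sdiff, mem_univ, mem_vAA, true_and]
    tauto

end Reduced

/-! ### §2 Virtual positivity of the classes without half internal edges -/

/-- **The inner `a = 0` block has nonnegative virtual value against every shifted nonnegative mask.** For `S′` `π`-stable
with `|S′| = 2N′`, `H` with no edge of `S′` inside and `b` edges meeting it, an odd inner cut `2s₁+1`, `R ≥ 1` with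
`R + 3D′ + b ≤ s₁+1`, `R + 3D′ + b + s₁ + 1 ≤ N′`, `(b/R)²e^{3b/R} ≤ 2`, weights `0 ≤ ψ ≤ G` on a finite `X ⊆ ℤ` and a shift
`m`: `0 ≤ N^{odd}_{D′}[c ↦ Σ_{x∈X} ψ(x)·law_{S′}(2s₁+1, c; x − m)](0)` (brick 121's criterion on the window `X` itself, fed at
every integer point by `ShellLawSmallBlockSmoothness.sum_centralBinom_mul_abs_fwdDiff_iter_shellLaw_le`).
[cite: Rothvoss2017, §2 (PDF p. 6)] [cite: Agarwal2000DifferenceEquations, Thm. 1.8.5 (1.8.6)] -/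
theorem classProfile_virtual_nonneg {π : Fin n → Fin n} (hπ : ∀ v, π (π v) = v) (hπ' : ∀ v, π v ≠ v)
    {S' : Finset (Fin n)} (hS' : ∀ v ∈ S', π v ∈ S') {N' : ℕ} (hN' : S'.card = 2 * N') (H : Finset (Fin n))
    (h0 : (reps π (vAA π S' H)).card = 0) {b : ℕ} (hb : (reps π (vBH π S' H ∪ vBN π S' H)).card = b)
    {s₁ D' R : ℕ} (hR : 1 ≤ R) (hR1 : R + 3 * D' + b ≤ s₁ + 1) (hR2 : R + 3 * D' + b + s₁ + 1 ≤ N')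
    (hq : ((b : ℝ) / R) ^ 2 * Real.exp (3 * b / R) ≤ 2) (X : Finset ℤ) (m : ℤ) (ψ : ℤ → ℝ) {G : ℝ}
    (hψ0 : ∀ x ∈ X, 0 ≤ ψ x) (hψG : ∀ x ∈ X, ψ x ≤ G) :
    0 ≤ (DesignRemainder.newtonPolyOdd D' (fun c => ∑ x ∈ X, ψ x * shellLaw π S' H (2 * s₁ + 1) c (x - m))).eval 0 := by
  classical
  have h := newtonPolyOdd_eval_zero_mixture_ge D' X X (Subset.refl _)
    (fun c x => shellLaw π S' H (2 * s₁ + 1) c (x - m)) (fun c x => by rw [shellLaw, shellCount]; positivity)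
    ψ hψ0 hψG (fun x _ => by
      have hb1 := sum_centralBinom_mul_abs_fwdDiff_iter_shellLaw_le hπ hπ' hS' hN' H h0 hb hR hR1 hR2 hq (x - m)
      have hfun : (fun j => shellLaw π S' H (2 * s₁ + 1) (2 * j + 1) (x - m)) =
          fun j => shellLaw π S' H (2 * s₁ + 1) (1 + 2 * j) (x - m) := by
        funext j; rw [Nat.add_comm 1 (2 * j)]
      simpa only [hfun] using hb1)
  rw [sdiff_self, Finset.bot_eq_empty, sum_empty, mul_zero, neg_zero] at h
  exact h

/-! ### §3 The pricing theorem, modulo the (K0) law identity -/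

/-- **SMALL BLOCKS WITH INTERNAL EDGES: THE UNTILTED MASK PRICED PER MATCHING (brick T-K3), modulo (K0).** For an exact
design `(n,t,T,D,B_v,C,w)`, a perfect matching `M` of `[n]` (`n = 2N`), a block `H` with `a` internal and `b` crossing
`M`-edges, `t = 2s₀+1`, `a + D′ = D`, `R ≥ 1` with `R + 3(D′+1) + b + a + (T−1)/2 ≤ s₀+1`,
`R + 3(D′+1) + b + a + s₀ + (T−1)/2 + 1 ≤ N`, `(b/R)²e^{3b/R} ≤ 2`, a mask `0 ≤ ψ ≤ G` on `[0,t]`, and the `HH`-class law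
identity `hK0` (lit's `ShellLawPopulationMixture` §9):
`|PM|·Σ_U W(U,M)·ψ(|U∩H|) ≤ B_v·C((T−1)/2, D′+1)·(3^a·G·(¼(b/R)²e^{3b/R})^{D′+1})`.
[cite: Rothvoss2017, §2 (PDF p. 6)] [cite: Agarwal2000DifferenceEquations, Remark 1.8.1 (1.8.8)] [cite: ChattamvelliShanmugam2020, §7.4] -/
theorem smallBlockHH_designValue_le_of_split {t T D : ℕ} {Bv : ℝ} {C : Finset ℕ} {w : ℕ → ℝ}
    (hdes : IsExactDesign n t T D Bv C w) (M : PMatch n) {N : ℕ} (hn : (univ : Finset (Fin n)).card = 2 * N)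
    (H : Finset (Fin n)) {a b : ℕ} (ha : (reps M.2.partner (vAA M.2.partner univ H)).card = a)
    (hb : (reps M.2.partner (vBH M.2.partner univ H ∪ vBN M.2.partner univ H)).card = b)
    {s₀ D' R : ℕ} (ht : t = 2 * s₀ + 1) (hD : a + D' = D) (hR : 1 ≤ R)
    (hR1 : R + 3 * (D' + 1) + b + a + (T - 1) / 2 ≤ s₀ + 1) (hR2 : R + 3 * (D' + 1) + b + a + s₀ + (T - 1) / 2 + 1 ≤ N)
    (hq : ((b : ℝ) / R) ^ 2 * Real.exp (3 * b / R) ≤ 2)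
    (ψ : ℤ → ℝ) {G : ℝ} (hG : ∀ x ∈ Icc (0 : ℤ) (t : ℤ), |ψ x| ≤ G) (hψ0 : ∀ x ∈ Icc (0 : ℤ) (t : ℤ), 0 ≤ ψ x)
    (hK0 : ∀ (s c : ℕ) (x : ℤ), s + c ≤ N →
      shellLaw M.2.partner univ H (2 * s + c) c x =
        ∑ f ∈ range (a + 1), ∑ g ∈ range (a - f + 1),
          (((a.choose f : ℕ) : ℝ) * ((a - f).choose g : ℕ) * (s.descFactorial f : ℕ) * (c.descFactorial g : ℕ) *
              ((N - s - c).descFactorial (a - f - g) : ℕ) / (N.descFactorial a : ℕ)) *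
            shellLaw M.2.partner (univ \ vAA M.2.partner univ H) H (2 * (s - f) + (c - g)) (c - g)
              (x - ((2 * f + g : ℕ) : ℤ))) :
    (Fintype.card (PMatch n) : ℝ) * ∑ U : OddSet n, levelWeight n t C w U M * ψ ((U.1 ∩ H).card : ℤ) ≤
      Bv * ((((T - 1) / 2).choose (D' + 1) : ℕ) : ℝ) *
        ((3 : ℝ) ^ a * (G * ((1 / 4 : ℝ) * ((b : ℝ) / R) ^ 2 * Real.exp (3 * b / R)) ^ (D' + 1))) := by
  classical
  subst ht
  set π := M.2.partner with hπdef
  have hπ : ∀ v, π (π v) = v := partner_partner M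
  have hπ' : ∀ v, π v ≠ v := partner_ne M
  obtain ⟨hS', hN', h0', hB'⟩ := sdiff_vAA_facts hπ hπ' hn H ha
  set S' := univ \ vAA π univ H with hS'def
  have hb' : (reps π (vBH π S' H ∪ vBN π S' H)).card = b := by rw [hB', hb]
  have hG0 : 0 ≤ G := (abs_nonneg _).trans (hG 0 (mem_Icc.2 ⟨le_rfl, by positivity⟩))
  have hTt : T ≤ 2 * s₀ + 1 := hdes.2.2.1
  have haN : a ≤ N := by omega
  set q : ℝ := (1 / 4 : ℝ) * ((b : ℝ) / R) ^ 2 * Real.exp (3 * b / R) with hqdef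
  have hq0 : 0 ≤ q := by rw [hqdef]; positivity
  set K : ℝ := G * q ^ (D' + 1) with hKdef
  have hK0' : 0 ≤ K := by rw [hKdef]; positivity
  -- the shell profile and its class decomposition on the design's levels
  set φ : ℕ → ℝ := fun c => (∑ U ∈ shell π (2 * s₀ + 1) c, ψ ((U ∩ H).card : ℤ)) /
    ((shell π (2 * s₀ + 1) c).card : ℝ) with hφ
  set Φ : ℕ → ℕ → ℕ → ℝ := fun f g c => ∑ x ∈ Icc (0 : ℤ) ((2 * s₀ + 1 : ℕ) : ℤ),
    ψ x * shellLaw π S' H (2 * s₀ + 1 - (2 * f + g)) (c - g) (x - ((2 * f + g : ℕ) : ℤ)) with hΦ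
  set p : ℕ → ℕ → ℝ[X] := fun f g => Polynomial.C (((a.choose f : ℕ) : ℝ) * ((a - f).choose g : ℕ) / (N.descFactorial a : ℕ)) *
    (∏ i ∈ range f, (Polynomial.C ((((2 * s₀ + 1 : ℕ) : ℝ)) / 2 - i) - Polynomial.C (1 / 2 : ℝ) * X)) *
    (∏ i ∈ range g, (X - Polynomial.C (i : ℝ))) *
    (∏ i ∈ range (a - f - g), (Polynomial.C ((N : ℝ) - (((2 * s₀ + 1 : ℕ) : ℝ)) / 2 - i) - Polynomial.C (1 / 2 : ℝ) * X))
    with hp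
  -- a design level `c ∈ C` is odd, `3 ≤ c ≤ T ≤ t`
  have hlev : ∀ c ∈ C, ∃ j : ℕ, c = 2 * j + 1 ∧ j ≤ (T - 1) / 2 ∧ j ≤ s₀ := by
    intro c hc
    obtain ⟨hodd, _, hcT, _⟩ := hdes.2.2.2.1 c hc
    obtain ⟨j, hj⟩ := hodd
    exact ⟨j, by omega, by omega, by omega⟩
  -- STEP A: the class decomposition `φ(c) = Σ_{f,g} p_{fg}(c)·Φ_{fg}(c)` on the levels
  have hsplit : ∀ c ∈ C, φ c = ∑ f ∈ range (a + 1), ∑ g ∈ range (a - f + 1), (p f g).eval (c : ℝ) * Φ f g c := by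
    intro c hc
    obtain ⟨j, rfl, hjT, hjs⟩ := hlev c hc
    have hsc : 2 * (s₀ - j) + (2 * j + 1) = 2 * s₀ + 1 := by omega
    have hsN : (s₀ - j) + (2 * j + 1) ≤ N := by omega
    rw [hφ]
    simp only
    rw [shellAvg_eq_sum_mul_shellLaw H (2 * s₀ + 1) (2 * j + 1) ψ]
    have hlaw : ∀ x : ℤ, shellLaw π univ H (2 * s₀ + 1) (2 * j + 1) x =
        ∑ f ∈ range (a + 1), ∑ g ∈ range (a - f + 1), (p f g).eval (((2 * j + 1 : ℕ) : ℝ)) *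
          shellLaw π S' H (2 * s₀ + 1 - (2 * f + g)) (2 * j + 1 - g) (x - ((2 * f + g : ℕ) : ℤ)) := by
      intro x
      rw [← hsc, hK0 (s₀ - j) (2 * j + 1) x hsN, hsc]
      refine sum_congr rfl fun f hf => sum_congr rfl fun g hg => ?_
      have hf' : f ≤ a := Nat.lt_succ_iff.1 (mem_range.1 hf)
      have hg' : g ≤ a - f := Nat.lt_succ_iff.1 (mem_range.1 hg)
      rw [hp]
      simp only
      rw [classWeight_eval_level _ hsc hsN f g (a - f - g)]
      by_cases hfs : f ≤ s₀ - j ∧ g ≤ 2 * j + 1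
      · rw [show 2 * (s₀ - j - f) + (2 * j + 1 - g) = 2 * s₀ + 1 - (2 * f + g) by omega]
        ring
      · -- an impossible class: its weight vanishes
        have hz : ((s₀ - j).descFactorial f : ℝ) * ((2 * j + 1).descFactorial g : ℕ) = 0 := by
          rcases not_and_or.1 hfs with h1 | h1
          · rw [Nat.descFactorial_eq_zero_iff_lt.2 (by omega), Nat.cast_zero, zero_mul]
          · rw [Nat.descFactorial_eq_zero_iff_lt.2 (by omega : 2 * j + 1 < g), Nat.cast_zero, mul_zero]
        have e1 : (((a.choose f : ℕ) : ℝ) * ((a - f).choose g : ℕ) * ((s₀ - j).descFactorial f : ℕ) *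
            ((2 * j + 1).descFactorial g : ℕ) * ((N - (s₀ - j) - (2 * j + 1)).descFactorial (a - f - g) : ℕ) /
            (N.descFactorial a : ℕ)) = 0 := by
          rw [show (((a.choose f : ℕ) : ℝ) * ((a - f).choose g : ℕ) * ((s₀ - j).descFactorial f : ℕ) *
            ((2 * j + 1).descFactorial g : ℕ)) = ((a.choose f : ℕ) : ℝ) * ((a - f).choose g : ℕ) *
            ((((s₀ - j).descFactorial f : ℕ) : ℝ) * ((2 * j + 1).descFactorial g : ℕ)) by ring, hz]
          simp
        have e2 : ((a.choose f : ℕ) : ℝ) * ((a - f).choose g : ℕ) / (N.descFactorial a : ℕ) *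
            ((s₀ - j).descFactorial f : ℕ) * ((2 * j + 1).descFactorial g : ℕ) *
            ((N - (s₀ - j) - (2 * j + 1)).descFactorial (a - f - g) : ℕ) = 0 := by
          rw [show ((a.choose f : ℕ) : ℝ) * ((a - f).choose g : ℕ) / (N.descFactorial a : ℕ) *
            ((s₀ - j).descFactorial f : ℕ) * ((2 * j + 1).descFactorial g : ℕ) =
            ((a.choose f : ℕ) : ℝ) * ((a - f).choose g : ℕ) / (N.descFactorial a : ℕ) *
            ((((s₀ - j).descFactorial f : ℕ) : ℝ) * ((2 * j + 1).descFactorial g : ℕ)) by ring, hz]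
          simp
        rw [e1, e2, zero_mul, zero_mul]
    simp only [hlaw, mul_sum]
    rw [sum_comm]
    refine sum_congr rfl fun f _ => ?_
    rw [sum_comm]
    refine sum_congr rfl fun g _ => ?_
    rw [hΦ]
    simp only [mul_sum]
    refine sum_congr rfl fun x _ => ?_
    ring
  -- STEP B/C/D: each class is priced at `C(a,f)C(a−f,g)·B_v·C((T−1)/2,D′+1)·K`
  have hclass : ∀ f ∈ range (a + 1), ∀ g ∈ range (a - f + 1),
      ∑ c ∈ C, w c * ((p f g).eval (c : ℝ) * Φ f g c) ≤
        Bv * (((a.choose f : ℕ) : ℝ) * ((a - f).choose g : ℕ)) * ((((T - 1) / 2).choose (D' + 1) : ℕ) : ℝ) * K := by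
    intro f hf g hg
    have hf' : f ≤ a := Nat.lt_succ_iff.1 (mem_range.1 hf)
    have hg' : g ≤ a - f := Nat.lt_succ_iff.1 (mem_range.1 hg)
    have hfge : f + g + (a - f - g) = a := by omega
    -- degree
    have hdeg : (p f g).natDegree + D' ≤ D := by
      have h := natDegree_classWeight_le (((a.choose f : ℕ) : ℝ) * ((a - f).choose g : ℕ) / (N.descFactorial a : ℕ))
        ((((2 * s₀ + 1 : ℕ) : ℝ)) / 2) ((N : ℝ) - (((2 * s₀ + 1 : ℕ) : ℝ)) / 2) f g (a - f - g)
      simp only [hp]; omega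
    -- size on the levels
    have hP : ∀ c ∈ C, |(p f g).eval (c : ℝ)| ≤ ((a.choose f : ℕ) : ℝ) * ((a - f).choose g : ℕ) := by
      intro c hc
      obtain ⟨j, rfl, hjT, hjs⟩ := hlev c hc
      have hsc : 2 * (s₀ - j) + (2 * j + 1) = 2 * s₀ + 1 := by omega
      have hsN : (s₀ - j) + (2 * j + 1) ≤ N := by omega
      obtain ⟨h1, h2⟩ := classWeight_eval_level_le (t := 2 * s₀ + 1) hsc hsN hfge haN
      rw [hp]
      simp only
      rw [abs_of_nonneg h1]
      exact h2
    -- smoothness of the class profile above the base `i₀ = g/2` (inner cut `2s₁ + c₀`, `c₀ = 1 − g % 2`)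
    have hgdm := Nat.div_add_mod g 2
    have hgm : g % 2 < 2 := Nat.mod_lt _ (by norm_num)
    have hKbd : ∀ j : ℕ, 2 * (j + g / 2 + D' + 1) + 1 ≤ T →
        |((fwdDiff (1 : ℕ))^[D' + 1] (fun j => Φ f g (2 * (j + g / 2) + 1))) j| ≤ K := by
      intro j hj
      have hfun : (fun j' => Φ f g (2 * (j' + g / 2) + 1)) = fun j' => ∑ x ∈ Icc (0 : ℤ) ((2 * s₀ + 1 : ℕ) : ℤ),
          ψ x * shellLaw π S' H (2 * (s₀ - f - g / 2) + (1 - g % 2)) ((1 - g % 2) + 2 * j') (x - ((2 * f + g : ℕ) : ℤ)) := by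
        funext j'
        rw [hΦ]
        simp only
        rw [show 2 * s₀ + 1 - (2 * f + g) = 2 * (s₀ - f - g / 2) + (1 - g % 2) by omega,
          show 2 * (j' + g / 2) + 1 - g = (1 - g % 2) + 2 * j' by omega]
      rw [hfun, hKdef, hqdef]
      exact abs_fwdDiff_iter_shiftedMixture_le hπ hπ' hS' hN' H h0' hb' hR (by omega) (by omega)
        (Icc (0 : ℤ) ((2 * s₀ + 1 : ℕ) : ℤ)) _ ψ hG0 hG
    rcases Nat.eq_zero_or_pos g with hg0 | hgpos
    · -- full/empty classes: main term `−p(0)·N_{D′}Φ(0) ≤ 0`, remainder priced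
      subst hg0
      have hKbd0 : ∀ j : ℕ, 2 * (j + D' + 1) + 1 ≤ T →
          |((fwdDiff (1 : ℕ))^[D' + 1] (fun j => Φ f 0 (2 * j + 1))) j| ≤ K := by
        intro j hj
        have h := hKbd j (by simpa using hj)
        simpa using h
      have hmain : 0 ≤ (p f 0).eval 0 * (DesignRemainder.newtonPolyOdd D' (Φ f 0)).eval 0 := by
        refine mul_nonneg ?_ ?_
        · rw [hp]
          simp only
          exact classWeight_eval_zero_nonneg (by positivity) (by omega) (by omega)
        · have hfun : Φ f 0 = fun c => ∑ x ∈ Icc (0 : ℤ) ((2 * s₀ + 1 : ℕ) : ℤ),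
              ψ x * shellLaw π S' H (2 * (s₀ - f) + 1) c (x - ((2 * f + 0 : ℕ) : ℤ)) := by
            funext c; rw [hΦ]; simp only [Nat.sub_zero, add_zero]
            rw [show 2 * s₀ + 1 - 2 * f = 2 * (s₀ - f) + 1 by omega]
          rw [hfun]
          exact classProfile_virtual_nonneg hπ hπ' hS' hN' H h0' hb' hR (by omega) (by omega) hq _ _ ψ hψ0
            (fun x hx => (le_abs_self _).trans (hG x hx))
      exact hdes.levelSum_mul_le_of_fwdDiff_odd (p f 0) hdeg hP (Φ f 0) hK0' hKbd0 hmain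
    · -- classes with a half internal edge: zero virtual weight, pure remainder
      have hpz : (p f g).eval 0 = 0 := by
        have h := classWeight_eval_eq_zero_of_lt (((a.choose f : ℕ) : ℝ) * ((a - f).choose g : ℕ) / (N.descFactorial a : ℕ))
          ((((2 * s₀ + 1 : ℕ) : ℝ)) / 2) ((N : ℝ) - (((2 * s₀ + 1 : ℕ) : ℝ)) / 2) f g (a - f - g) (c := 0) hgpos
        rw [hp]; simpa using h
      have hp0 : ∀ c ∈ C, c < 2 * (g / 2) + 1 → (p f g).eval (c : ℝ) = 0 := by
        intro c hc hlt
        obtain ⟨j, rfl, _, _⟩ := hlev c hc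
        rw [hp]
        exact classWeight_eval_eq_zero_of_lt _ _ _ f g (a - f - g) (by omega)
      have habs := hdes.abs_levelSum_mul_le_of_eval_zero (p f g) hdeg hpz hp0 hP (Φ f g) hK0' hKbd
      exact (le_abs_self _).trans habs
  -- STEP E: `|PM|·Σ_U W ψ = Σ_c w_c φ(c)` and the class sum
  have hPM : (Fintype.card (PMatch n) : ℝ) ≠ 0 := by
    have : 0 < Fintype.card (PMatch n) := Fintype.card_pos_iff.2 ⟨M⟩
    positivity
  rw [designValue_eq_shellAvg (2 * s₀ + 1) hdes.1 C w M (fun U => ψ ((U ∩ H).card : ℤ)), ← mul_assoc,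
    mul_inv_cancel₀ hPM, one_mul]
  have hBv : 0 ≤ Bv := (sum_nonneg fun c _ => abs_nonneg (w c)).trans hdes.variation_le
  calc ∑ c ∈ C, w c * φ c
      = ∑ c ∈ C, ∑ f ∈ range (a + 1), ∑ g ∈ range (a - f + 1), w c * ((p f g).eval (c : ℝ) * Φ f g c) := by
        refine sum_congr rfl fun c hc => ?_
        rw [hsplit c hc, mul_sum]
        refine sum_congr rfl fun f _ => ?_
        rw [mul_sum]
    _ = ∑ f ∈ range (a + 1), ∑ g ∈ range (a - f + 1), ∑ c ∈ C, w c * ((p f g).eval (c : ℝ) * Φ f g c) := by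
        rw [sum_comm]
        refine sum_congr rfl fun f _ => ?_
        rw [sum_comm]
    _ ≤ ∑ f ∈ range (a + 1), ∑ g ∈ range (a - f + 1),
          Bv * (((a.choose f : ℕ) : ℝ) * ((a - f).choose g : ℕ)) * ((((T - 1) / 2).choose (D' + 1) : ℕ) : ℝ) * K :=
        sum_le_sum fun f hf => sum_le_sum fun g hg => hclass f hf g hg
    _ = Bv * ((((T - 1) / 2).choose (D' + 1) : ℕ) : ℝ) *
          ((∑ f ∈ range (a + 1), ∑ g ∈ range (a - f + 1), ((a.choose f : ℕ) : ℝ) * ((a - f).choose g : ℕ)) * K) := by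
        rw [sum_mul, mul_sum]
        refine sum_congr rfl fun f _ => ?_
        rw [sum_mul, mul_sum]
        refine sum_congr rfl fun g _ => ?_
        ring
    _ = _ := by rw [sum_choose_mul_choose_eq_three_pow, hKdef]

/-- **SMALL BLOCKS WITH INTERNAL EDGES: THE UNTILTED MASK PRICED PER MATCHING (brick T-K3).** For an exact design
`(n,t,T,D,B_v,C,w)`, a perfect matching `M` of `[n]` (`n = 2N`), a block `H` with `a` internal and `b` crossing `M`-edges,
`t = 2s₀+1`, `a + D′ = D`, `R ≥ 1` with `R + 3(D′+1) + b + a + (T−1)/2 ≤ s₀+1`, `R + 3(D′+1) + b + a + s₀ + (T−1)/2 + 1 ≤ N`,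
`(b/R)²e^{3b/R} ≤ 2`, and every mask `0 ≤ ψ ≤ G` on `[0,t]`:
`|PM|·Σ_U W(U,M)·ψ(|U∩H|) ≤ B_v·C((T−1)/2, D′+1)·3^a·G·(¼(b/R)²e^{3b/R})^{D′+1}` — §3 with the (K0) law identity
supplied by lit g37's `ShellLawPopulationMixture.shellLaw_eq_sum_split_hh_descFactorial`.
[cite: Rothvoss2017, §2 (PDF p. 6)] [cite: Agarwal2000DifferenceEquations, Remark 1.8.1 (1.8.8)] [cite: ChattamvelliShanmugam2020, §7.4] -/
theorem smallBlockHH_designValue_le {t T D : ℕ} {Bv : ℝ} {C : Finset ℕ} {w : ℕ → ℝ}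
    (hdes : IsExactDesign n t T D Bv C w) (M : PMatch n) {N : ℕ} (hn : (univ : Finset (Fin n)).card = 2 * N)
    (H : Finset (Fin n)) {a b : ℕ} (ha : (reps M.2.partner (vAA M.2.partner univ H)).card = a)
    (hb : (reps M.2.partner (vBH M.2.partner univ H ∪ vBN M.2.partner univ H)).card = b)
    {s₀ D' R : ℕ} (ht : t = 2 * s₀ + 1) (hD : a + D' = D) (hR : 1 ≤ R)
    (hR1 : R + 3 * (D' + 1) + b + a + (T - 1) / 2 ≤ s₀ + 1) (hR2 : R + 3 * (D' + 1) + b + a + s₀ + (T - 1) / 2 + 1 ≤ N)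
    (hq : ((b : ℝ) / R) ^ 2 * Real.exp (3 * b / R) ≤ 2)
    (ψ : ℤ → ℝ) {G : ℝ} (hG : ∀ x ∈ Icc (0 : ℤ) (t : ℤ), |ψ x| ≤ G) (hψ0 : ∀ x ∈ Icc (0 : ℤ) (t : ℤ), 0 ≤ ψ x) :
    (Fintype.card (PMatch n) : ℝ) * ∑ U : OddSet n, levelWeight n t C w U M * ψ ((U.1 ∩ H).card : ℤ) ≤
      Bv * ((((T - 1) / 2).choose (D' + 1) : ℕ) : ℝ) *
        ((3 : ℝ) ^ a * (G * ((1 / 4 : ℝ) * ((b : ℝ) / R) ^ 2 * Real.exp (3 * b / R)) ^ (D' + 1))) :=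
  smallBlockHH_designValue_le_of_split hdes M hn H ha hb ht hD hR hR1 hR2 hq ψ hG hψ0 (fun s c x hsc => by
    rw [shellLaw_eq_sum_split_hh_descFactorial (partner_partner M) (partner_ne M) (fun v _ => mem_univ _) hn H ha
      s c hsc x]
    refine sum_congr rfl fun f _ => sum_congr rfl fun g _ => ?_
    rw [show (((2 * f + g : ℕ)) : ℤ) = 2 * (f : ℤ) + (g : ℤ) by push_cast; ring])

end Summit.PneNP.PneNP.Theorems.ChebyshevTracialDesignSmallBlockMaskPricingHH

end
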